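import Literature.Analysis.Complex.VerticalSinSummation
import Mathlib.Analysis.SpecialFunctions.ImproperIntegrals
import Mathlib.Analysis.PSeries
import HarnessLib

/-!
# The cotangent summation formula `Σ_{n > c} h(n) = −½ ∫ h(c+iy) cot(π(c+iy)) dy`

Topic `Literature/Analysis/Complex` (contour integration), continuing
`VerticalSinSummation.lean`. Everything here is PROVED; no definitions, no named facts.

* `hasSum_int_mul_cot` — let `c ∈ ℝ ∖ ℤ` and `h` be complex differentiable on an open set
  containing the closed half-plane `{re z ≥ c}`, with `‖h z‖ ≤ C/(1 + ‖z‖²)` there. Then the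
  series `Σ_{n ∈ ℤ, n > c} h(n)` converges absolutely and equals
  `−½ ∫_{−∞}^{∞} h(c + iy) cot(π(c + iy)) dy` (we write `cot = cos/sin`).

Proof: the finite-strip residue theorem
`Literature.Analysis.Complex.integral_vertical_mul_cot_sub_eq_sum` on `c ≤ re z ≤ N + ½`
(the poles of `π cot(πz)` are the integers, simple, residue `1`), then `N → ∞`: on the
half-integer lines `|cot| ≤ 1`, so the right integrals are `≪ 1/N²` and tend to `0` by dominated
convergence, while `|cot(π(x+iT))| ≤ 2` for `|T| ≥ 1` controls the cross-sections.

This is the device turning sums of values of a rational (or hypergeometric-type) function at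
integers into Barnes-type line integrals, e.g. [Zudilin, *Irrationality of values of the Riemann
zeta function*, Izv. Math. 66 (2002), §4, Lemma 2]: `Σ_t R^{(b−1)}(t)/(b−1)! =
−(1/2πi) ∫_{M−i∞}^{M+i∞} π^b cot_b(πt) R(t) dt`. Classical (Lindelöf, *Le calcul des résidus*
(1905), Ch. III §§13–15); tagged folklore.
-/

noncomputable section

open _root_.Complex Set MeasureTheory Filter intervalIntegral Real
open scoped _root_.Topology

namespace Literature.Analysis.Complex

/-! ### Letting the right line tend to `+∞`: the cotangent summation formula -/

/-- A holomorphic function on `{re z ≥ c}` with `‖h z‖ ≤ C/(1+‖z‖²)` there is absolutely summable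
over the integers `> c`. [folklore] -/
theorem summable_norm_int_shift {h : ℂ → ℂ} {c C : ℝ}
    (hbound : ∀ z : ℂ, c ≤ z.re → ‖h z‖ ≤ C / (1 + ‖z‖ ^ 2)) :
    Summable fun k : ℕ ↦ ‖h ((⌊c⌋ + 1 + k : ℤ) : ℂ)‖ := by
  set a : ℝ := (⌊c⌋ : ℝ) with ha
  have hC : 0 ≤ C := by
    have h := hbound ((⌊c⌋ + 1 : ℤ) : ℂ) (by simpa using (Int.lt_floor_add_one c).le)
    have h0 : (0 : ℝ) < 1 + ‖((⌊c⌋ + 1 : ℤ) : ℂ)‖ ^ 2 := by positivity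
    exact (div_nonneg_iff.1 ((norm_nonneg _).trans h)).elim (fun h => h.1)
      (fun h => absurd h.2 (not_le.2 h0))
  -- compare with `C (1 + a²) / (k+1)²`
  have hcmp : ∀ k : ℕ, ‖h ((⌊c⌋ + 1 + k : ℤ) : ℂ)‖ ≤ C * (1 + a ^ 2) * (1 / ((k : ℝ) + 1) ^ 2) := by
    intro k
    have hre : c ≤ (((⌊c⌋ + 1 + k : ℤ) : ℂ)).re := by
      simp only [Complex.intCast_re]; push_cast
      have := (Int.lt_floor_add_one c).le
      have hk : (0 : ℝ) ≤ k := Nat.cast_nonneg k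
      linarith
    refine (hbound _ hre).trans ?_
    have hnorm : ‖((⌊c⌋ + 1 + k : ℤ) : ℂ)‖ ^ 2 = ((k : ℝ) + 1 + a) ^ 2 := by
      rw [Complex.norm_intCast, sq_abs]; push_cast; rw [ha]; ring
    rw [hnorm]
    have hx : (0 : ℝ) < (k : ℝ) + 1 := by positivity
    -- Cauchy–Schwarz: `x² ≤ ((x+a)² + 1)(1 + a²)` with `x = k+1`
    have key : ((k : ℝ) + 1) ^ 2 ≤ (1 + ((k : ℝ) + 1 + a) ^ 2) * (1 + a ^ 2) := by
      nlinarith [sq_nonneg (((k : ℝ) + 1 + a) * a + 1), sq_nonneg ((k : ℝ) + 1 + a - a)]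
    have hge : 1 ≤ (1 + a ^ 2) * (1 + ((k : ℝ) + 1 + a) ^ 2) / ((k : ℝ) + 1) ^ 2 := by
      rw [le_div_iff₀ (by positivity)]; linarith [key]
    rw [div_le_iff₀ (by positivity)]
    have hrw : C * (1 + a ^ 2) * (1 / ((k : ℝ) + 1) ^ 2) * (1 + ((k : ℝ) + 1 + a) ^ 2) =
        C * ((1 + a ^ 2) * (1 + ((k : ℝ) + 1 + a) ^ 2) / ((k : ℝ) + 1) ^ 2) := by
      field_simp
    rw [hrw]
    nlinarith [mul_le_mul_of_nonneg_left hge hC]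
  refine Summable.of_nonneg_of_le (fun k ↦ norm_nonneg _) hcmp ?_
  refine Summable.mul_left _ ?_
  have := (summable_nat_add_iff 1).2 (Real.summable_one_div_nat_pow.2 one_lt_two)
  simpa using this

/-- **Cotangent summation formula.** Let `c` be a real non-integer and `h` complex differentiable
on an open set containing the closed half-plane `{re z ≥ c}`, with `‖h z‖ ≤ C/(1 + ‖z‖²)` there.
Then `Σ_{n ∈ ℤ, n > c} h(n) = −½ ∫ h(c + iy) cot(π(c + iy)) dy` (absolutely convergent on both
sides; `cot = cos/sin`). Proof: `integral_vertical_mul_cot_sub_eq_sum` on `[c, N + ½]` and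
`N → ∞`, the right line integral tending to `0` by dominated convergence. [folklore] -/
theorem hasSum_int_mul_cot {h : ℂ → ℂ} {c C : ℝ} (hc : ∀ n : ℤ, (n : ℝ) ≠ c)
    (U : Set ℂ) (hU : IsOpen U) (hKU : re ⁻¹' Ici c ⊆ U) (hh : DifferentiableOn ℂ h U)
    (hbound : ∀ z : ℂ, c ≤ z.re → ‖h z‖ ≤ C / (1 + ‖z‖ ^ 2)) :
    HasSum (fun k : ℕ ↦ h ((⌊c⌋ + 1 + k : ℤ) : ℂ))
      (-(1 / 2) * ∫ y : ℝ, h (c + y * I) * Complex.cos (π * (c + y * I)) /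
        Complex.sin (π * (c + y * I))) := by
  classical
  have hC : 0 ≤ C := by
    have h := hbound ((⌊c⌋ + 1 : ℤ) : ℂ) (by simpa using (Int.lt_floor_add_one c).le)
    have h0 : (0 : ℝ) < 1 + ‖((⌊c⌋ + 1 : ℤ) : ℂ)‖ ^ 2 := by positivity
    exact (div_nonneg_iff.1 ((norm_nonneg _).trans h)).elim (fun h => h.1)
      (fun h => absurd h.2 (not_le.2 h0))
  -- notation: the integrand on the line `re z = x`
  set F : ℂ → ℂ := fun z ↦ h z * Complex.cos (π * z) / Complex.sin (π * z) with hF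
  have hπ0 : (0 : ℝ) < π := Real.pi_pos
  -- continuity of `F` along a line `re z = x` not through an integer
  have hcontline : ∀ x : ℝ, c ≤ x → Real.sin (π * x) ≠ 0 →
      Continuous fun y : ℝ ↦ F (x + y * I) := by
    intro x hx hsx
    have hline : Continuous fun y : ℝ ↦ (x : ℂ) + y * I := by fun_prop
    have hmem : ∀ y : ℝ, (x : ℂ) + y * I ∈ U := fun y ↦ hKU (by simp [hx])
    have h1 : Continuous fun y : ℝ ↦ h (x + y * I) :=
      (hh.continuousOn.comp_continuous hline hmem)
    have h2 : Continuous fun y : ℝ ↦ Complex.cos (π * (x + y * I)) := by fun_prop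
    have h3 : Continuous fun y : ℝ ↦ Complex.sin (π * (x + y * I)) := by fun_prop
    have h4 : ∀ y : ℝ, Complex.sin (π * (x + y * I)) ≠ 0 := by
      intro y h0
      have := abs_sin_re_le_norm_sin (π * (x + y * I))
      rw [h0, norm_zero] at this
      have hre : (π * ((x : ℂ) + y * I)).re = π * x := by simp
      rw [hre] at this
      exact hsx (abs_eq_zero.1 (le_antisymm this (abs_nonneg _)))
    simp only [hF]
    exact (h1.mul h2).div h3 h4
  -- pointwise bound of `F` on a line `re z = x ≥ c`
  have hFbound : ∀ (x y : ℝ), c ≤ x → ∀ B : ℝ,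
      ‖Complex.cos (π * (x + y * I)) / Complex.sin (π * (x + y * I))‖ ≤ B →
      ‖F (x + y * I)‖ ≤ C * B / (1 + y ^ 2) := by
    intro x y hx B hB
    have hB0 : 0 ≤ B := (norm_nonneg _).trans hB
    simp only [hF]
    rw [mul_div_assoc, norm_mul]
    have hh1 := hbound ((x : ℂ) + y * I) (by simp [hx])
    have hy : 1 + y ^ 2 ≤ 1 + ‖(x : ℂ) + y * I‖ ^ 2 := by
      have : |y| ≤ ‖(x : ℂ) + y * I‖ := by
        simpa using Complex.abs_im_le_norm ((x : ℂ) + y * I)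
      nlinarith [sq_abs y, norm_nonneg ((x : ℂ) + y * I), abs_nonneg y]
    have hh2 : ‖h ((x : ℂ) + y * I)‖ ≤ C / (1 + y ^ 2) :=
      hh1.trans (div_le_div_of_nonneg_left hC (by positivity) hy)
    calc ‖h ((x : ℂ) + y * I)‖ * ‖Complex.cos (π * (x + y * I)) / Complex.sin (π * (x + y * I))‖
        ≤ C / (1 + y ^ 2) * B := mul_le_mul hh2 hB (norm_nonneg _) (by positivity)
      _ = C * B / (1 + y ^ 2) := by ring
  -- integrability on a line not through an integer
  have hint : ∀ x : ℝ, c ≤ x → Real.sin (π * x) ≠ 0 → Integrable fun y : ℝ ↦ F (x + y * I) := by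
    intro x hx hsx
    have hB : ∀ y : ℝ, ‖Complex.cos (π * (x + y * I)) / Complex.sin (π * (x + y * I))‖ ≤
        |Real.sin (π * x)|⁻¹ := fun y ↦ by
      have := norm_cos_div_sin_le_inv_abs_sin (π * ((x : ℂ) + y * I)) (by simpa using hsx)
      simpa using this
    refine Integrable.mono' ((integrable_inv_one_add_sq.const_mul (C * |Real.sin (π * x)|⁻¹)))
      (hcontline x hx hsx).aestronglyMeasurable (Eventually.of_forall fun y ↦ ?_)
    have := hFbound x y hx _ (hB y)
    simpa [div_eq_mul_inv] using this
  -- `sin(πx) ≠ 0` off the integers, `|sin(π b)| = 1` at half-integers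
  have hsin_ne : ∀ x : ℝ, (∀ n : ℤ, (n : ℝ) ≠ x) → Real.sin (π * x) ≠ 0 := by
    intro x hx
    rw [Real.sin_ne_zero_iff]
    intro n hn
    apply hx n
    have : (n : ℝ) * π = x * π := by rw [mul_comm x]; exact hn
    exact mul_right_cancel₀ Real.pi_ne_zero this
  have hsc : Real.sin (π * c) ≠ 0 := hsin_ne c hc
  -- the right lines `re z = b N = ⌊c⌋ + N + 3/2`
  set b : ℕ → ℝ := fun N ↦ (⌊c⌋ : ℝ) + N + 3 / 2 with hb
  have hcb : ∀ N, c < b N := fun N ↦ by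
    have h1 : c < (⌊c⌋ : ℝ) + 1 := Int.lt_floor_add_one c
    have hN : (0 : ℝ) ≤ N := Nat.cast_nonneg N
    simp only [hb]; linarith
  have hbint : ∀ (N : ℕ) (n : ℤ), (n : ℝ) ≠ b N := by
    intro N n hn
    simp only [hb] at hn
    have h2 : (2 * (n - ⌊c⌋ - N) : ℤ) = 3 := by
      have : (2 * (n - ⌊c⌋ - N) : ℝ) = 3 := by linarith
      exact_mod_cast this
    omega
  have hsinb : ∀ N, Real.sin (π * b N) ≠ 0 := fun N ↦ hsin_ne (b N) (hbint N)
  have habs_sinb : ∀ N, |Real.sin (π * b N)| = 1 := by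
    intro N
    have : π * b N = π / 2 + ((⌊c⌋ + N + 1 : ℤ) : ℝ) * π := by
      simp only [hb]; push_cast; ring
    rw [this, Real.sin_add_int_mul_pi, Real.sin_pi_div_two, mul_one, abs_zpow, abs_neg, abs_one,
      one_zpow]
  have hfloorb : ∀ N : ℕ, ⌊b N⌋ = ⌊c⌋ + N + 1 := by
    intro N
    rw [Int.floor_eq_iff]
    simp only [hb]; push_cast
    constructor <;> linarith
  -- uniform smallness on the horizontal cross-sections
  have hdecayN : ∀ N : ℕ, ∀ ε : ℝ, 0 < ε → ∃ T₀ : ℝ, ∀ T : ℝ, T₀ ≤ |T| → ∀ x ∈ Icc c (b N),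
      ‖F (x + T * I)‖ ≤ ε := by
    intro N ε hε
    refine ⟨max 1 (2 * C / ε), fun T hT x hx ↦ ?_⟩
    have hT1 : 1 ≤ |T| := le_of_max_le_left hT
    have hT2 : 2 * C / ε ≤ |T| := le_of_max_le_right hT
    have hB : ‖Complex.cos (π * (x + T * I)) / Complex.sin (π * (x + T * I))‖ ≤ 2 := by
      refine norm_cos_div_sin_le_two _ ?_
      have : (π * ((x : ℂ) + T * I)).im = π * T := by simp
      rw [this, abs_mul, abs_of_pos hπ0]
      nlinarith [Real.pi_gt_three]
    have h1 := hFbound x T hx.1 2 hB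
    refine h1.trans ?_
    rw [div_le_iff₀ (by positivity)]
    have hT0 : 0 < |T| := zero_lt_one.trans_le hT1
    have h2 : 2 * C ≤ ε * |T| := by rw [div_le_iff₀ hε] at hT2; linarith
    nlinarith [sq_abs T, hT1, hε]
  -- the finite-strip identity
  have hstrip : ∀ N : ℕ, (∫ y : ℝ, F (b N + y * I)) - ∫ y : ℝ, F (c + y * I) =
      2 * ∑ n ∈ Finset.Ioc ⌊c⌋ (⌊c⌋ + N + 1), h n := by
    intro N
    have := integral_vertical_mul_cot_sub_eq_sum (hcb N) hc (hbint N) U hU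
      (fun z hz ↦ hKU hz.1) hh (hint c le_rfl hsc) (hint (b N) (hcb N).le (hsinb N)) (hdecayN N)
    rwa [hfloorb N] at this
  -- the right integrals tend to zero (dominated convergence)
  have hright : Tendsto (fun N : ℕ ↦ ∫ y : ℝ, F (b N + y * I)) atTop (𝓝 0) := by
    have hbd : ∀ (N : ℕ) (y : ℝ), ‖F (b N + y * I)‖ ≤ C / (1 + (b N) ^ 2) := by
      intro N y
      simp only [hF]
      rw [mul_div_assoc, norm_mul]
      have hB : ‖Complex.cos (π * (b N + y * I)) / Complex.sin (π * (b N + y * I))‖ ≤ 1 := by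
        have := norm_cos_div_sin_le_inv_abs_sin (π * ((b N : ℂ) + y * I)) (by simpa using hsinb N)
        have hre : (π * ((b N : ℂ) + y * I)).re = π * b N := by simp
        rw [hre, habs_sinb N, inv_one] at this
        exact this
      have hh1 := hbound ((b N : ℂ) + y * I) (by simpa using (hcb N).le)
      have hx : 1 + (b N) ^ 2 ≤ 1 + ‖(b N : ℂ) + y * I‖ ^ 2 := by
        have : |b N| ≤ ‖(b N : ℂ) + y * I‖ := by
          simpa using Complex.abs_re_le_norm ((b N : ℂ) + y * I)
        nlinarith [sq_abs (b N), norm_nonneg ((b N : ℂ) + y * I), abs_nonneg (b N)]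
      have hh2 : ‖h ((b N : ℂ) + y * I)‖ ≤ C / (1 + (b N) ^ 2) :=
        hh1.trans (div_le_div_of_nonneg_left hC (by positivity) hx)
      calc ‖h ((b N : ℂ) + y * I)‖ *
            ‖Complex.cos (π * (b N + y * I)) / Complex.sin (π * (b N + y * I))‖
          ≤ C / (1 + (b N) ^ 2) * 1 := mul_le_mul hh2 hB (norm_nonneg _) (by positivity)
        _ = C / (1 + (b N) ^ 2) := mul_one _
    have hbd' : ∀ (N : ℕ) (y : ℝ), ‖F (b N + y * I)‖ ≤ C / (1 + y ^ 2) := by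
      intro N y
      have hB : ‖Complex.cos (π * (b N + y * I)) / Complex.sin (π * (b N + y * I))‖ ≤ 1 := by
        have := norm_cos_div_sin_le_inv_abs_sin (π * ((b N : ℂ) + y * I)) (by simpa using hsinb N)
        have hre : (π * ((b N : ℂ) + y * I)).re = π * b N := by simp
        rw [hre, habs_sinb N, inv_one] at this
        exact this
      have := hFbound (b N) y (hcb N).le 1 hB
      simpa using this
    have hbN : Tendsto (fun N : ℕ ↦ C / (1 + (b N) ^ 2)) atTop (𝓝 0) := by
      have hbt : Tendsto b atTop atTop := by
        simp only [hb]
        refine tendsto_atTop_add_const_right _ _ (tendsto_atTop_add_const_left _ _ ?_)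
        exact tendsto_natCast_atTop_atTop
      have h2 : Tendsto (fun N : ℕ ↦ 1 + (b N) ^ 2) atTop atTop :=
        tendsto_atTop_add_const_left _ _ (tendsto_pow_atTop two_ne_zero |>.comp hbt)
      simpa [div_eq_mul_inv] using h2.inv_tendsto_atTop.const_mul C
    have hlim0 : ∀ y : ℝ, Tendsto (fun N : ℕ ↦ F (b N + y * I)) atTop (𝓝 0) := fun y ↦
      squeeze_zero_norm (fun N ↦ hbd N y) hbN
    have hdom : Integrable fun y : ℝ ↦ C / (1 + y ^ 2) := by
      simpa [div_eq_mul_inv] using integrable_inv_one_add_sq.const_mul C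
    have h := tendsto_integral_filter_of_dominated_convergence (fun y ↦ C / (1 + y ^ 2))
      (Eventually.of_forall fun N ↦ (hcontline (b N) (hcb N).le (hsinb N)).aestronglyMeasurable)
      (Eventually.of_forall fun N ↦ Eventually.of_forall (hbd' N)) hdom
      (Eventually.of_forall hlim0)
    simpa using h
  -- partial sums
  have hpartial : Tendsto (fun N : ℕ ↦ ∑ n ∈ Finset.Ioc ⌊c⌋ (⌊c⌋ + N + 1), h n) atTop
      (𝓝 (-(1 / 2) * ∫ y : ℝ, F (c + y * I))) := by
    have h2 : Tendsto (fun N : ℕ ↦ ((∫ y : ℝ, F (b N + y * I)) - ∫ y : ℝ, F (c + y * I)) / 2)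
        atTop (𝓝 ((0 - ∫ y : ℝ, F (c + y * I)) / 2)) :=
      (hright.sub tendsto_const_nhds).div_const 2
    have h3 : (0 - ∫ y : ℝ, F (c + y * I)) / 2 = -(1 / 2) * ∫ y : ℝ, F (c + y * I) := by ring
    rw [h3] at h2
    refine h2.congr fun N ↦ ?_
    rw [hstrip N]; ring
  -- reindex over `ℕ`
  have hreindex : ∀ N : ℕ, ∑ n ∈ Finset.Ioc ⌊c⌋ (⌊c⌋ + N + 1), h n =
      ∑ k ∈ Finset.range (N + 1), h ((⌊c⌋ + 1 + k : ℤ) : ℂ) := by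
    intro N
    have hset : Finset.Ioc ⌊c⌋ (⌊c⌋ + N + 1) =
        (Finset.range (N + 1)).map ⟨fun k : ℕ ↦ ⌊c⌋ + 1 + k, fun a b hab ↦ by
          simpa using hab⟩ := by
      ext n
      simp only [Finset.mem_Ioc, Finset.mem_map, Finset.mem_range, Function.Embedding.coeFn_mk]
      constructor
      · rintro ⟨h1, h2⟩
        exact ⟨(n - ⌊c⌋ - 1).toNat, by omega, by omega⟩
      · rintro ⟨k, hk, rfl⟩
        omega
    rw [hset, Finset.sum_map]
    rfl
  rw [hasSum_iff_tendsto_nat_of_summable_norm (summable_norm_int_shift hbound),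
    ← tendsto_add_atTop_iff_nat 1]
  have := hpartial.congr fun N ↦ hreindex N
  simpa [hF] using this

end Literature.Analysis.Complex
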